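import Literature.MathematicalPhysics.QuantumFieldTheory.Balaban1983to89.B9Thm31CubeLocalFlat
import Literature.MathematicalPhysics.QuantumFieldTheory.Balaban1983to89.B9CubeCoarsening

/-!
# `Balaban1983to89.B9Thm31CubeLocalFlatMember` — [B9] THEOREM 3.1 (3.42) AT `U = 1` FOR THE CUBE-LOCAL LETTER `G′_□` IN THE MEMBER'S
# CURRENCY: the four sup entries of `G′_□(1) = GpCubeW` (weights `wCube`) as POINTWISE BOUNDS OVER THE MEMBER'S BLOCKS AND (2.46) DISTANCE
# (`B6Geom246MultiLevelTorus.geomT D`, `B6Geom246MultiLevelBox.blkOf` — def-Y's `BlkY`, p21's ∕ p38's `geo9K`) for sources in member blocks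
# near □ — file 2 v1.1 §6 carried through file 1b's `majorant_transfer_of_nearH` (sub-row G-B9-LETTERS, module M5.1a, file 2d)

FRAMING (verbatim cell line):
statement-level skeleton of published theorems with citation tags; proofs where landed; nothing here is a claim about the Yang–Mills mass gap

Sources under audit (cell lit-balaban): T. Bałaban, *Propagators for lattice gauge theories in a background field*, Commun. Math. Phys. **99**
(1985) 389–434 [`Balaban1985BackgroundPropagators`, "B9"], Thm 3.1 (3.42) p. 397, Cor. 3.5 p. 407, (3.89) p. 409; T. Bałaban, *Propagators and
renormalization transformations for lattice gauge theories. II*, Commun. Math. Phys. **96** (1984) 223–250 [`Balaban1984PropagatorsII`, "[4]"],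
Prop. 2.2 (2.67) p. 234, (2.46) p. 231, (2.51) p. 232.  Unit `lit-balaban-r05` (r05 gen 77).

## WHAT IS PRINTED (verbatim up to notation)

[B9] (3.42) p. 397: «|(G′(U)λ)(x)|, |(∇_UG′(U)λ)(x)|, |(G′(U)∇*_Uλ)(x)|, |(Δ_UG′(U)λ)(x)| ≦ B₀[(L^jη)², L^jη, L^jη, 1]e^{−δ₀d(y,y′)}|λ| for
x ∈ Δ(y), y ∈ Λ_j, supp λ ⊂ Δ(y′)»; p. 409: the cube letters satisfy these, and (3.89) uses them «for x ∈ Δ(y), supp λ ⊂ Δ(y′), y, y′ ∈ □» —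
i.e. in the MEMBER's blocks near □.

## WHAT THIS FILE CERTIFIES (kernel-checked; lattice units; `F := cubeFam D q …`, `G′_□ := GpCubeW D q …`)

**`thm31_cubeW_member`**: there are `δ₀, C, M₀ > 0`, `N₀ ≥ 1` (functions of `d, L` only) such that for every member `D` (odd `L ≥ 2`, odd
`M_h ≥ 3`, `L·M_h ≥ M₀`, `R ≥ 2L`, `R·L·M_h ≥ N₀ + 1`, `P ≥ 4`), every cover cube `q`, every MEMBER block `y′` containing a site near □
(`B9CubeSequence408.NearH`), every `λ` with `supp λ ⊂ y′`, `|λ| ≤ B`, every torus point `x` (member block `y(x)`, member level `j = lev_D x`)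
and every axis `μ`:
`|(G′_□λ)(x)| ≤ C·L^{2j}·e^{−(δ₀/2)d(y(x),y′)}·B`, `|(∂_μG′_□λ)(x)| ≤ C·L^{j}·e^{…}·B`, `|(G′_□∂_μᵀλ)(x)| ≤ C·L^{j}·e^{…}·B`,
`|((−Δ^{per})G′_□λ)(x)| ≤ C·e^{…}·B` — `d` = the MEMBER's (2.46) distance.  Mechanism: file 2 v1.1 `thm31_cubeW_flat_first ∕ second ∕ third ∕ sixth`
(block majorants over the cube sequence's geometry; constants merged by `max ∕ min`) and file 1b `majorant_transfer_of_nearH` (levels only grow,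
distances only shrink under coarsening; a member block with a site near □ is a cube block).

## HONEST SCOPE

* `U = 1`; sources in member blocks NEAR □ only (the use of p. 409); the global member-currency form (any source block; loss `δ ↦ δ′`, factor
  `c₁` of Lemma 2.1) is not in this file.  Cube family of file 1 (single scale, mass-`a = a₀ = a₁ = 1` floor, (3.24) p. 394).
* Nothing is inferred from the manuscript; kernel-checked.  NOT summit progress; the YM mass gap is not proved by any of this.
-/

namespace Literature.MathematicalPhysics.QuantumFieldTheory.Balaban1983to89.B9Thm31CubeLocalFlatMember

open Literature.MathematicalPhysics.QuantumFieldTheory.Balaban1983to89.B4Reflection242 (boxDom)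
open Literature.MathematicalPhysics.QuantumFieldTheory.Balaban1983to89.B6MultiLevelBoxOperator (N0)
open Literature.MathematicalPhysics.QuantumFieldTheory.Balaban1983to89.B6MultiLevelTorusOperator (perLapT)
open Literature.MathematicalPhysics.QuantumFieldTheory.Balaban1983to89.B6Cover236MultiLevelBlocks (cubes)
open Literature.MathematicalPhysics.QuantumFieldTheory.Balaban1983to89.B6Geom246MultiLevelBox (bset blkOf)
open Literature.MathematicalPhysics.QuantumFieldTheory.Balaban1983to89.B6Geom246MultiLevelTorus (geomT)
open Literature.MathematicalPhysics.QuantumFieldTheory.Balaban1983to89.B6Geom246MultiLevelTorusL0 (triangle_refl_nonneg_T)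
open Literature.MathematicalPhysics.QuantumFieldTheory.Balaban1983to89.B6RandomWalk (HasMajorant BlockSupp hasMajorant_mono)
open Literature.MathematicalPhysics.QuantumFieldTheory.Balaban1983to89.B6Prop22DerivMultiLevelTorus (dT)
open Literature.MathematicalPhysics.QuantumFieldTheory.Balaban1983to89.B9CubeSequence408 (cubeFam NearH)
open Literature.MathematicalPhysics.QuantumFieldTheory.Balaban1983to89.B9CubeCoarsening (majorant_transfer_of_nearH)
open Literature.MathematicalPhysics.QuantumFieldTheory.Balaban1983to89.B9Thm31CubeLocalFlat (GpCubeW thm31_cubeW_flat_first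
  thm31_cubeW_flat_second thm31_cubeW_flat_third thm31_cubeW_flat_sixth)
open scoped Matrix

variable {d : ℕ}

/-- **THEOREM 3.1 (3.42) AT `U = 1` FOR `G′_□`, ALL FOUR SUP ENTRIES, IN THE MEMBER'S BLOCKS AND DISTANCE, FOR SOURCES NEAR □** (one set of
constants for every member and every cube). [cite: Balaban1985BackgroundPropagators, Thm 3.1 (3.42) p.397 with Cor. 3.5 p.407 and p.409 l.1–5, (3.89) p.409; Balaban1984PropagatorsII, Prop. 2.2 (2.67) p.234, (2.46) p.231, (2.51) p.232] -/
theorem thm31_cubeW_member (d ℓ : ℕ) (hℓ : 1 ≤ ℓ) :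
    ∃ δ₀ C M₀ : ℝ, ∃ N₀ : ℕ, 0 < δ₀ ∧ 0 < C ∧ 0 < M₀ ∧ 0 < N₀ ∧
      ∀ {Mh k R : ℕ} {P : Fin (d + 1) → ℕ} (D : B6MultiLevelTorusOperator.TDomains d ℓ Mh k P R)
        (q : ↥(cubes D.toDomains)) (hL : Odd (ℓ + 1)) (hM : Odd Mh) (hMh : 1 ≤ Mh) (hP : ∀ μ, 1 ≤ P μ),
        3 ≤ Mh → M₀ ≤ ((ℓ : ℝ) + 1) * Mh → 2 * (ℓ + 1) ≤ R → N₀ + 1 ≤ R * ((ℓ + 1) * Mh) → (∀ μ, 4 ≤ P μ) →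
        ∀ (y' : ↥(bset D.toDomains)) (x₀ : ↥(boxDom (N0 ℓ Mh k P))), blkOf D.toDomains x₀ = y' → NearH q x₀.1 →
        ∀ (lam : ↥(boxDom (N0 ℓ Mh k P)) → ℝ) (B : ℝ), BlockSupp (g := geomT D) (blkOf D.toDomains) lam y' B →
        ∀ x : ↥(boxDom (N0 ℓ Mh k P)),
          |(GpCubeW D q hL hM hMh hP *ᵥ lam) x| ≤
              C * ((ℓ : ℝ) + 1) ^ (2 * D.lev x.1) * Real.exp (-(δ₀ / 2 * (geomT D).dist (blkOf D.toDomains x) y')) * B ∧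
          (∀ μ : Fin (d + 1), |((dT (N0 ℓ Mh k P) μ * GpCubeW D q hL hM hMh hP) *ᵥ lam) x| ≤
              C * ((ℓ : ℝ) + 1) ^ D.lev x.1 * Real.exp (-(δ₀ / 2 * (geomT D).dist (blkOf D.toDomains x) y')) * B) ∧
          (∀ μ : Fin (d + 1), |((GpCubeW D q hL hM hMh hP * (dT (N0 ℓ Mh k P) μ).transpose) *ᵥ lam) x| ≤
              C * ((ℓ : ℝ) + 1) ^ D.lev x.1 * Real.exp (-(δ₀ / 2 * (geomT D).dist (blkOf D.toDomains x) y')) * B) ∧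
          |((perLapT (N0 ℓ Mh k P) * GpCubeW D q hL hM hMh hP) *ᵥ lam) x| ≤
              C * Real.exp (-(δ₀ / 2 * (geomT D).dist (blkOf D.toDomains x) y')) * B := by
  obtain ⟨δa, Ca, Ma, Na, hδa, hCa, hMa, hNa, hA⟩ := thm31_cubeW_flat_first d ℓ hℓ
  obtain ⟨δb, Cb, Mb, Nb, hδb, hCb, hMb, hNb, hB⟩ := thm31_cubeW_flat_second d ℓ hℓ
  obtain ⟨δc, Cc, Mc, Nc, hδc, hCc, hMc, hNc, hCC⟩ := thm31_cubeW_flat_third d ℓ hℓ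
  obtain ⟨δe, Ce, Me, Ne, hδe, hCe, hMe, hNe, hE⟩ := thm31_cubeW_flat_sixth d ℓ hℓ
  -- merged constants
  refine ⟨min (min δa δb) (min δc δe), max (max Ca Cb) (max Cc Ce), max (max Ma Mb) (max Mc Me), max (max Na Nb) (max Nc Ne),
    lt_min (lt_min hδa hδb) (lt_min hδc hδe), lt_max_of_lt_left (lt_max_of_lt_left hCa),
    lt_max_of_lt_left (lt_max_of_lt_left hMa), lt_max_of_lt_left (lt_max_of_lt_left hNa), ?_⟩
  intro Mh k R P D q hL hM hMh hP h3 hM0 hR hN0 hP4 y' x₀ hy' hx₀ lam B hlam x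
  set δ₀ := min (min δa δb) (min δc δe) with hδ₀
  set C := max (max Ca Cb) (max Cc Ce) with hC
  have hC0 : 0 ≤ C := le_trans hCa.le ((le_max_left _ _).trans (le_max_left _ _))
  have hδ00 : 0 ≤ δ₀ / 2 := by have := lt_min (lt_min hδa hδb) (lt_min hδc hδe); rw [← hδ₀] at this; linarith
  have hR2 : 2 ≤ R := by omega
  have hL0 : (0 : ℝ) ≤ (ℓ : ℝ) + 1 := by positivity
  -- thresholds
  have hMa' : Ma ≤ ((ℓ : ℝ) + 1) * Mh := ((le_max_left _ _).trans (le_max_left _ _)).trans hM0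
  have hMb' : Mb ≤ ((ℓ : ℝ) + 1) * Mh := ((le_max_right _ _).trans (le_max_left _ _)).trans hM0
  have hMc' : Mc ≤ ((ℓ : ℝ) + 1) * Mh := ((le_max_left _ _).trans (le_max_right _ _)).trans hM0
  have hMe' : Me ≤ ((ℓ : ℝ) + 1) * Mh := ((le_max_right _ _).trans (le_max_right _ _)).trans hM0
  have hNa' : Na + 1 ≤ R * ((ℓ + 1) * Mh) := le_trans (Nat.succ_le_succ ((le_max_left _ _).trans (le_max_left _ _))) hN0
  have hNb' : Nb + 1 ≤ R * ((ℓ + 1) * Mh) := le_trans (Nat.succ_le_succ ((le_max_right _ _).trans (le_max_left _ _))) hN0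
  have hNc' : Nc + 1 ≤ R * ((ℓ + 1) * Mh) := le_trans (Nat.succ_le_succ ((le_max_left _ _).trans (le_max_right _ _))) hN0
  have hNe' : Ne + 1 ≤ R * ((ℓ + 1) * Mh) := le_trans (Nat.succ_le_succ ((le_max_right _ _).trans (le_max_right _ _))) hN0
  -- the cube-geometry distance is non-negative
  have hdist := (triangle_refl_nonneg_T (cubeFam D q hL hM hMh hP) hMh hP).2.2
  -- weakening of a cube majorant to the merged constants, in the shape `C·L^{n·j}·e^{−(δ₀/2)·d}` of file 1b
  have hmono : ∀ (Cx δx : ℝ) (n : ℕ), Cx ≤ C → δ₀ ≤ δx → 0 ≤ Cx →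
      ∀ y y' : (B6Geom246MultiLevelTorusL0.geomT (cubeFam D q hL hM hMh hP)).Site,
        Cx * ((ℓ : ℝ) + 1) ^ n * Real.exp (-(δx / 2 * (B6Geom246MultiLevelTorusL0.geomT (cubeFam D q hL hM hMh hP)).dist y y')) ≤
          C * ((ℓ : ℝ) + 1) ^ n * Real.exp (-(δ₀ / 2 * (B6Geom246MultiLevelTorusL0.geomT (cubeFam D q hL hM hMh hP)).dist y y')) := by
    intro Cx δx n hCx hδx hCx0 y y'
    have hd := hdist y y'
    refine mul_le_mul (mul_le_mul_of_nonneg_right hCx (pow_nonneg hL0 n)) (Real.exp_le_exp.2 ?_) (Real.exp_nonneg _)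
      (mul_nonneg hC0 (pow_nonneg hL0 n))
    nlinarith
  -- the transfer of file 1b at exponent `n` and rate `δ₀/2`
  have transfer : ∀ {T : Module.End ℝ (↥(boxDom (N0 ℓ Mh k P)) → ℝ)} (n : ℕ),
      HasMajorant (g := B6Geom246MultiLevelTorusL0.geomT (cubeFam D q hL hM hMh hP))
        (B6Geom246MultiLevelBoxL0.blkOf (cubeFam D q hL hM hMh hP).toDomains) T
        (fun y y' => C * ((ℓ : ℝ) + 1) ^ (n * y.1.1) *
          Real.exp (-(δ₀ / 2 * (B6Geom246MultiLevelTorusL0.geomT (cubeFam D q hL hM hMh hP)).dist y y'))) →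
      |T lam x| ≤ C * ((ℓ : ℝ) + 1) ^ (n * D.lev x.1) * Real.exp (-(δ₀ / 2 * (geomT D).dist (blkOf D.toDomains x) y')) * B :=
    fun n hT => majorant_transfer_of_nearH hR2 hC0 hδ00 hT y' hy' hx₀ lam B hlam x
  refine ⟨?_, fun μ => ?_, fun μ => ?_, ?_⟩
  · -- entry 1: `n = 2`
    have h := transfer 2 (hasMajorant_mono _ (hA D q hL hM hMh hP h3 hMa' hR hNa' hP4) fun y y' =>
      hmono Ca δa (2 * y.1.1) ((le_max_left _ _).trans (le_max_left _ _)) ((min_le_left _ _).trans (min_le_left _ _)) hCa.le y y')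
    rw [Matrix.toLin'_apply] at h
    exact h
  · -- entry 2: `n = 1`
    have h := transfer 1 (hasMajorant_mono _ (hB D q hL hM hMh hP h3 hMb' hR hNb' hP4 μ) fun y y' => by
      rw [one_mul]
      exact hmono Cb δb y.1.1 ((le_max_right _ _).trans (le_max_left _ _)) ((min_le_left _ _).trans (min_le_right _ _)) hCb.le y y')
    rw [Matrix.toLin'_apply, one_mul] at h
    exact h
  · -- entry 3: `n = 1`
    have h := transfer 1 (hasMajorant_mono _ (hCC D q hL hM hMh hP h3 hMc' hR hNc' hP4 μ) fun y y' => by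
      rw [one_mul]
      exact hmono Cc δc y.1.1 ((le_max_left _ _).trans (le_max_right _ _)) ((min_le_right _ _).trans (min_le_left _ _)) hCc.le y y')
    rw [Matrix.toLin'_apply, one_mul] at h
    exact h
  · -- entry 6: `n = 0`
    have h := transfer 0 (hasMajorant_mono _ (hE D q hL hM hMh hP h3 hMe' hR hNe' hP4) fun y y' => by
      rw [zero_mul, pow_zero, mul_one]
      have := hmono Ce δe 0 ((le_max_right _ _).trans (le_max_right _ _)) ((min_le_right _ _).trans (min_le_right _ _)) hCe.le y y'
      rw [pow_zero, mul_one, mul_one] at this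
      exact this)
    rw [Matrix.toLin'_apply, zero_mul, pow_zero, mul_one] at h
    exact h

end Literature.MathematicalPhysics.QuantumFieldTheory.Balaban1983to89.B9Thm31CubeLocalFlatMember
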